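import Literature.Probability.Divergences.RenyiDivergence
import Summits.AtomisticToContinuum.HydrodynamicLimit.Theorems.OneFlightGossipEngineAssemblyEntropyTransport
import Literature.MathematicalPhysics.KineticTheory.LocalGibbsConstEquivalence
import HarnessLib

/-!
# Crux `RestartPrinciple` (stmt-AtomisticToContinuum-12503), line `isentropic-regibbsification` —
# transport of Hellinger integrals / Rényi divergences along a hard-sphere flow

Support file for the lead's stub `stub_renyiLocalEquilibrium` (the Rényi short-time local
equilibrium bet). Its first split (line card §First split, reduction (R2)) begins with the
LIOUVILLE IDENTITY: the Hellinger integral of order `1 + γ` of the pushed-forward fresh local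
Gibbs law `(Φ_r)_* (f dZ)` against a reference `g dZ` is an explicit phase-space exponential
moment under the fresh law, `∫ f^{1+γ} (g ∘ Φ_r)^{-γ} dZ`. This file proves the measure theory:

* `hellingerIntegral_map_eq_of_leftInvOn`, `renyiDiv_map_eq_of_leftInvOn` — invariance of the
  Hellinger integral and of the Rényi divergence of order `> 1` under a map with a measurable
  left inverse on a set carrying both (finite) measures (the `klDiv` twin is
  `Literature.MathematicalPhysics.StatisticalMechanics.klDiv_map_eq_of_leftInvOn`);
* `hellingerIntegral_lawAt_eq`, `renyiDiv_lawAt_eq` — `D_r((Φ_t)_* μ ‖ ν) = D_r(μ ‖ (Φ_{-t})_* ν)`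
  for Liouville-a.c. finite laws and a hard-sphere flow `Φ`;
* `hellingerIntegral_lawAt_withDensity_eq`, `renyiDiv_lawAt_withDensity_eq` — density form
  `D_r((Φ_t)_*(f dZ) ‖ g dZ) = D_r(f dZ ‖ (g∘Φ_t) dZ)`.
-/

noncomputable section

open MeasureTheory Set Filter InformationTheory
open Literature.Probability.Divergences Literature.Analysis.FluidPDE
open scoped ENNReal

namespace Summit.AtomisticToContinuum.HydrodynamicLimit.Theorems.RestartPrinciple.IsentropicRegibbsification

/-! ## Invariance under almost invertible maps -/

section General

variable {X Y : Type*} [MeasurableSpace X] [MeasurableSpace Y]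

/-- If `h ∘ g = id` on a set `A` of full `μ`-measure then `h_* g_* μ = μ`. [folklore] -/
theorem map_map_eq_self_of_leftInvOn {μ : Measure X} {g : X → Y} {h : Y → X} (hg : Measurable g)
    (hh : Measurable h) {A : Set X} (hμA : μ Aᶜ = 0) (hinv : ∀ x ∈ A, h (g x) = x) :
    (μ.map g).map h = μ := by
  have hae : (h ∘ g) =ᵐ[μ] id := by
    filter_upwards [mem_ae_iff.2 hμA] with x hx using hinv x hx
  rw [Measure.map_map hh hg, Measure.map_congr hae, Measure.map_id]

/-- Absolute continuity is preserved and reflected by a map with a measurable left inverse on a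
set carrying both measures. [folklore] -/
theorem absolutelyContinuous_map_iff_of_leftInvOn {a b : Measure X} {g : X → Y} {h : Y → X}
    (hg : Measurable g) (hh : Measurable h) {A : Set X} (haA : a Aᶜ = 0) (hbA : b Aᶜ = 0)
    (hinv : ∀ x ∈ A, h (g x) = x) : a.map g ≪ b.map g ↔ a ≪ b := by
  refine ⟨fun h' => ?_, fun h' => h'.map hg⟩
  have h'' := h'.map hh
  rwa [map_map_eq_self_of_leftInvOn hg hh haA hinv, map_map_eq_self_of_leftInvOn hg hh hbA hinv]
    at h''

/-- The density of the image measures, pulled back along `g`, is a density of `a` with respect to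
`b` (when `a ≪ b`). [folklore] -/
theorem rnDeriv_ae_eq_rnDeriv_map_comp {a b : Measure X} [IsFiniteMeasure a] [IsFiniteMeasure b]
    {g : X → Y} {h : Y → X} (hg : Measurable g) (hh : Measurable h) {A : Set X}
    (hA : MeasurableSet A) (haA : a Aᶜ = 0) (hbA : b Aᶜ = 0) (hinv : ∀ x ∈ A, h (g x) = x)
    (hab : a ≪ b) : a.rnDeriv b =ᵐ[b] fun x => (a.map g).rnDeriv (b.map g) (g x) := by
  have hab' : a.map g ≪ b.map g := hab.map hg
  set ρ' := (a.map g).rnDeriv (b.map g) with hρ'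
  have hρ'm : Measurable ρ' := Measure.measurable_rnDeriv _ _
  -- the sets `g ⁻¹' (h ⁻¹' (s ∩ A))` and `s` agree on `A`
  have hsets : ∀ {s : Set X} (μ : Measure X), μ Aᶜ = 0 →
      (g ⁻¹' (h ⁻¹' (s ∩ A)) : Set X) =ᵐ[μ] s := fun {s} μ hμ => by
    refine Filter.eventuallyEq_set.2 ?_
    filter_upwards [mem_ae_iff.2 hμ] with x hx
    simp only [mem_preimage, mem_inter_iff, hinv x hx]
    exact ⟨fun h1 => h1.1, fun h1 => ⟨h1, hx⟩⟩
  have hdens : b.withDensity (ρ' ∘ g) = a := by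
    ext s hs
    have hBm : MeasurableSet (h ⁻¹' (s ∩ A)) := hh (hs.inter hA)
    calc b.withDensity (ρ' ∘ g) s
        = ∫⁻ x in s, ρ' (g x) ∂b := withDensity_apply _ hs
      _ = ∫⁻ x in g ⁻¹' (h ⁻¹' (s ∩ A)), ρ' (g x) ∂b := (setLIntegral_congr (hsets b hbA)).symm
      _ = ∫⁻ y in h ⁻¹' (s ∩ A), ρ' y ∂(b.map g) := (setLIntegral_map hBm hρ'm hg).symm
      _ = (b.map g).withDensity ρ' (h ⁻¹' (s ∩ A)) := (withDensity_apply _ hBm).symm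
      _ = a.map g (h ⁻¹' (s ∩ A)) := by rw [hρ', Measure.withDensity_rnDeriv_eq _ _ hab']
      _ = a (g ⁻¹' (h ⁻¹' (s ∩ A))) := Measure.map_apply hg hBm
      _ = a s := measure_congr (hsets a haA)
  have h1 := Measure.rnDeriv_withDensity b (hρ'm.comp hg)
  rwa [hdens] at h1

/-- **Transport of the Hellinger integral of order `r > 1` along an almost invertible map.** If
`g` has a measurable left inverse `h` on a measurable set `A` carrying both finite measures `a`
and `b`, then `∫ (d g_*a / d g_*b)^r d g_*b = ∫ (da/db)^r db` (both `∞` unless `a ≪ b`).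
[folklore] -/
theorem hellingerIntegral_map_eq_of_leftInvOn {a b : Measure X} [IsFiniteMeasure a]
    [IsFiniteMeasure b] {g : X → Y} {h : Y → X} (hg : Measurable g) (hh : Measurable h)
    {A : Set X} (hA : MeasurableSet A) (haA : a Aᶜ = 0) (hbA : b Aᶜ = 0)
    (hinv : ∀ x ∈ A, h (g x) = x) {r : ℝ} (hr : 1 < r) :
    hellingerIntegral r (a.map g) (b.map g) = hellingerIntegral r a b := by
  by_cases hab : a ≪ b
  · have hab' : a.map g ≪ b.map g := hab.map hg
    rw [hellingerIntegral_of_ac hab, hellingerIntegral_of_ac hab']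
    have hρ'm : Measurable fun y => (a.map g).rnDeriv (b.map g) y ^ r :=
      (Measure.measurable_rnDeriv _ _).pow_const r
    rw [lintegral_map hρ'm hg]
    refine lintegral_congr_ae ?_
    filter_upwards [rnDeriv_ae_eq_rnDeriv_map_comp hg hh hA haA hbA hinv hab] with x hx
    rw [hx]
  · have hab' : ¬ a.map g ≪ b.map g :=
      fun h' => hab ((absolutelyContinuous_map_iff_of_leftInvOn hg hh haA hbA hinv).1 h')
    have hs : a.singularPart b univ ≠ 0 := by
      rw [ne_eq, Measure.measure_univ_eq_zero, Measure.singularPart_eq_zero]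
      exact hab
    have hs' : (a.map g).singularPart (b.map g) univ ≠ 0 := by
      rw [ne_eq, Measure.measure_univ_eq_zero, Measure.singularPart_eq_zero]
      exact hab'
    rw [hellingerIntegral, hellingerIntegral, if_pos hr, if_pos hr, ENNReal.top_mul hs,
      ENNReal.top_mul hs', add_top, add_top]

/-- **Transport of the Rényi divergence of order `r > 1` along an almost invertible map.**
[folklore] -/
theorem renyiDiv_map_eq_of_leftInvOn {a b : Measure X} [IsFiniteMeasure a] [IsFiniteMeasure b]
    {g : X → Y} {h : Y → X} (hg : Measurable g) (hh : Measurable h) {A : Set X}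
    (hA : MeasurableSet A) (haA : a Aᶜ = 0) (hbA : b Aᶜ = 0) (hinv : ∀ x ∈ A, h (g x) = x)
    {r : ℝ} (hr : 1 < r) : renyiDiv r (a.map g) (b.map g) = renyiDiv r a b := by
  rw [renyiDiv_of_ne_one hr.ne', renyiDiv_of_ne_one hr.ne',
    hellingerIntegral_map_eq_of_leftInvOn hg hh hA haA hbA hinv hr]

end General

/-! ## Along a hard-sphere flow -/

section Flow

variable {d : Type*} [Fintype d] {X : Type*} [MeasureSpace X] [TopologicalSpace X] {N : ℕ}
  {G : Geometry d X} {ε : ℝ}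

/-- **Transport of the Hellinger integral along a hard-sphere flow** (order `r > 1`): for finite
laws `μ, ν ≪ dZ`, `∫ (d(Φ_t)_*μ / dν)^r dν = ∫ (dμ / d(Φ_{-t})_*ν)^r d(Φ_{-t})_*ν` — `Φ_t` is
injective on the conull invariant good set with inverse `Φ_{-t}`, and `ν = (Φ_t)_* (Φ_{-t})_* ν`.
[folklore] -/
theorem hellingerIntegral_lawAt_eq (Φ : HardSphereFlow G ε N) (μ ν : Measure (Config N d X))
    [IsFiniteMeasure μ] [IsFiniteMeasure ν] (hμ : μ ≪ liouville G N ε)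
    (hν : ν ≪ liouville G N ε) {r : ℝ} (hr : 1 < r) (t : ℝ) :
    hellingerIntegral r (Φ.lawAt μ t) ν = hellingerIntegral r μ (ν.map (Φ.flow (-t))) := by
  have hb : (ν.map (Φ.flow (-t))) Φ.goodᶜ = 0 := by
    rw [Measure.map_apply (Φ.measurable_flow (-t)) Φ.measurableSet_good.compl]
    refine hν (measure_mono_null (fun z hz => ?_) Φ.measure_compl_good)
    simp only [mem_preimage, mem_compl_iff] at hz ⊢
    exact fun hz' => hz (Φ.mapsTo_good (-t) hz')
  have key := hellingerIntegral_map_eq_of_leftInvOn (a := μ) (b := ν.map (Φ.flow (-t)))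
    (Φ.measurable_flow t) (Φ.measurable_flow (-t)) Φ.measurableSet_good (hμ Φ.measure_compl_good)
    hb (fun z hz => Φ.flow_neg_flow t hz) hr
  rw [hardSphereFlow_map_flow_neg_map_flow Φ ν hν t] at key
  rw [HardSphereFlow.lawAt_eq, key]

/-- **Transport of the Rényi divergence along a hard-sphere flow** (order `r > 1`):
`D_r((Φ_t)_* μ ‖ ν) = D_r(μ ‖ (Φ_{-t})_* ν)` for finite laws `μ, ν ≪ dZ`. [folklore] -/
theorem renyiDiv_lawAt_eq (Φ : HardSphereFlow G ε N) (μ ν : Measure (Config N d X))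
    [IsFiniteMeasure μ] [IsFiniteMeasure ν] (hμ : μ ≪ liouville G N ε)
    (hν : ν ≪ liouville G N ε) {r : ℝ} (hr : 1 < r) (t : ℝ) :
    renyiDiv r (Φ.lawAt μ t) ν = renyiDiv r μ (ν.map (Φ.flow (-t))) := by
  rw [renyiDiv_of_ne_one hr.ne', renyiDiv_of_ne_one hr.ne', hellingerIntegral_lawAt_eq Φ μ ν hμ hν hr]

/-- **Density form** (mild Liouville equation): for measurable densities `f, g` with finite laws,
`∫ (d(Φ_t)_*(f dZ) / d(g dZ))^r d(g dZ) = ∫ (d(f dZ) / d((g∘Φ_t) dZ))^r d((g∘Φ_t) dZ)`, `r > 1`.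
[folklore] -/
theorem hellingerIntegral_lawAt_withDensity_eq (Φ : HardSphereFlow G ε N)
    {f g : Config N d X → ℝ≥0∞} (hg : Measurable g)
    [IsFiniteMeasure ((liouville G N ε).withDensity f)]
    [IsFiniteMeasure ((liouville G N ε).withDensity g)] {r : ℝ} (hr : 1 < r) (t : ℝ) :
    hellingerIntegral r (Φ.lawAt ((liouville G N ε).withDensity f) t)
        ((liouville G N ε).withDensity g) =
      hellingerIntegral r ((liouville G N ε).withDensity f)
        ((liouville G N ε).withDensity fun z => g (Φ.flow t z)) := by
  rw [hellingerIntegral_lawAt_eq Φ _ _ (withDensity_absolutelyContinuous _ _)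
    (withDensity_absolutelyContinuous _ _) hr t]
  congr 1
  have h := HardSphereFlow.lawAt_withDensity_holds Φ hg (-t)
  rw [HardSphereFlow.lawAt_eq] at h
  rw [h]
  congr 1
  funext z
  simp [HardSphereFlow.transportDensity]

/-- **Density form for the Rényi divergence** (`r > 1`):
`D_r((Φ_t)_*(f dZ) ‖ g dZ) = D_r(f dZ ‖ (g ∘ Φ_t) dZ)`. [folklore] -/
theorem renyiDiv_lawAt_withDensity_eq (Φ : HardSphereFlow G ε N)
    {f g : Config N d X → ℝ≥0∞} (hg : Measurable g)
    [IsFiniteMeasure ((liouville G N ε).withDensity f)]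
    [IsFiniteMeasure ((liouville G N ε).withDensity g)] {r : ℝ} (hr : 1 < r) (t : ℝ) :
    renyiDiv r (Φ.lawAt ((liouville G N ε).withDensity f) t) ((liouville G N ε).withDensity g) =
      renyiDiv r ((liouville G N ε).withDensity f)
        ((liouville G N ε).withDensity fun z => g (Φ.flow t z)) := by
  rw [renyiDiv_of_ne_one hr.ne', renyiDiv_of_ne_one hr.ne',
    hellingerIntegral_lawAt_withDensity_eq Φ hg hr t]

end Flow

/-! ## Explicit form for laws with densities -/

section Explicit

variable {X : Type*} [MeasurableSpace X]

/-- Two densities `f, g` with `g` finite and `f = 0` wherever `g = 0` (a.e.): `f dL` has density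
`f / g` with respect to `g dL`. [folklore] -/
theorem withDensity_withDensity_mul_inv_eq {L : Measure X} {f g : X → ℝ≥0∞} (hf : Measurable f)
    (hg : Measurable g) (hg_top : ∀ x, g x ≠ ∞) (hfg : ∀ᵐ x ∂L, g x = 0 → f x = 0) :
    (L.withDensity g).withDensity (fun x => f x * (g x)⁻¹) = L.withDensity f := by
  rw [show (fun x => f x * (g x)⁻¹) = f * g⁻¹ from rfl, ← withDensity_mul L hg (hf.mul hg.inv)]
  refine withDensity_congr_ae ?_
  filter_upwards [hfg] with x hx
  simp only [Pi.mul_apply, Pi.inv_apply]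
  by_cases h0 : g x = 0
  · rw [h0, hx h0, zero_mul]
  · rw [mul_comm (f x), ← mul_assoc, ENNReal.mul_inv_cancel h0 (hg_top x), one_mul]

/-- Under the same hypotheses, `d(f dL)/d(g dL) = f / g` almost everywhere for `g dL`
(`g dL` σ-finite). [folklore] -/
theorem rnDeriv_withDensity_withDensity_ae_eq {L : Measure X} {f g : X → ℝ≥0∞} (hf : Measurable f)
    (hg : Measurable g) (hg_top : ∀ x, g x ≠ ∞) (hfg : ∀ᵐ x ∂L, g x = 0 → f x = 0)
    [SigmaFinite (L.withDensity g)] :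
    (L.withDensity f).rnDeriv (L.withDensity g) =ᵐ[L.withDensity g] fun x => f x * (g x)⁻¹ := by
  have h := Measure.rnDeriv_withDensity (L.withDensity g)
    (show Measurable fun x => f x * (g x)⁻¹ from hf.mul hg.inv)
  rw [withDensity_withDensity_mul_inv_eq hf hg hg_top hfg] at h
  exact h

/-- **Explicit Hellinger integral of two laws with densities**: if `g` is finite and `f` vanishes
(a.e.) where `g` does, then for every order `r`,
`∫ (d(f dL)/d(g dL))^r d(g dL) = ∫ g · (f/g)^r dL` (`= ∫ f^r g^{1-r} dL`). [folklore] -/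
theorem hellingerIntegral_withDensity_eq_lintegral {L : Measure X} {f g : X → ℝ≥0∞}
    (hf : Measurable f) (hg : Measurable g) (hg_top : ∀ x, g x ≠ ∞)
    (hfg : ∀ᵐ x ∂L, g x = 0 → f x = 0) [SigmaFinite (L.withDensity g)] (r : ℝ) :
    hellingerIntegral r (L.withDensity f) (L.withDensity g) =
      ∫⁻ x, g x * (f x * (g x)⁻¹) ^ r ∂L := by
  have hac : L.withDensity f ≪ L.withDensity g := by
    rw [← withDensity_withDensity_mul_inv_eq hf hg hg_top hfg]
    exact withDensity_absolutelyContinuous _ _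
  rw [hellingerIntegral_of_ac hac]
  have hmeas : Measurable fun x => (f x * (g x)⁻¹) ^ r := (hf.mul hg.inv).pow_const r
  calc ∫⁻ x, (L.withDensity f).rnDeriv (L.withDensity g) x ^ r ∂(L.withDensity g)
      = ∫⁻ x, (f x * (g x)⁻¹) ^ r ∂(L.withDensity g) := by
        refine lintegral_congr_ae ?_
        filter_upwards [rnDeriv_withDensity_withDensity_ae_eq hf hg hg_top hfg] with x hx
        rw [hx]
    _ = ∫⁻ x, g x * (f x * (g x)⁻¹) ^ r ∂L := by
        rw [lintegral_withDensity_eq_lintegral_mul L hg hmeas]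
        rfl

end Explicit

/-! ## The Liouville identity for the Rényi pair of the line -/

section Liouville

variable {d : Type*} [Fintype d] {X : Type*} [MeasureSpace X] [TopologicalSpace X] {N : ℕ}
  {G : Geometry d X} {ε : ℝ}

/-- **Liouville identity for the Hellinger integral along a hard-sphere flow.** For measurable
densities `f, g` with finite laws, `g` finite, and `f = 0` a.e. where `g ∘ Φ_t = 0`, the
Hellinger integral of order `r > 1` of the pushed-forward law `(Φ_t)_* (f dZ)` against `g dZ`
is the explicit phase-space integral `∫ (g∘Φ_t) · (f / g∘Φ_t)^r dZ` — for `r = 1 + γ` the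
exponential moment `E_{f dZ}[(f / g∘Φ_t)^γ]` of the log-likelihood drop along the flow.
[folklore] -/
theorem hellingerIntegral_lawAt_withDensity_eq_lintegral (Φ : HardSphereFlow G ε N)
    {f g : Config N d X → ℝ≥0∞} (hf : Measurable f) (hg : Measurable g) (hg_top : ∀ z, g z ≠ ∞)
    [IsFiniteMeasure ((liouville G N ε).withDensity f)]
    [IsFiniteMeasure ((liouville G N ε).withDensity g)] {r : ℝ} (hr : 1 < r) (t : ℝ)
    (hfg : ∀ᵐ z ∂(liouville G N ε), g (Φ.flow t z) = 0 → f z = 0) :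
    hellingerIntegral r (Φ.lawAt ((liouville G N ε).withDensity f) t)
        ((liouville G N ε).withDensity g) =
      ∫⁻ z, g (Φ.flow t z) * (f z * (g (Φ.flow t z))⁻¹) ^ r ∂(liouville G N ε) := by
  rw [hellingerIntegral_lawAt_withDensity_eq Φ hg hr t]
  -- the transported reference `(g ∘ Φ_t) dZ = (Φ_{-t})_* (g dZ)` is a finite measure
  have hfin : IsFiniteMeasure ((liouville G N ε).withDensity fun z => g (Φ.flow t z)) := by
    have h := HardSphereFlow.lawAt_withDensity_holds Φ hg (-t)
    have h' : ((liouville G N ε).withDensity fun z => g (Φ.flow t z)) =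
        Φ.lawAt ((liouville G N ε).withDensity g) (-t) := by
      rw [h]
      congr 1
      funext z
      simp [HardSphereFlow.transportDensity]
    rw [h', HardSphereFlow.lawAt_eq]
    infer_instance
  haveI := hfin
  exact hellingerIntegral_withDensity_eq_lintegral (g := fun z => g (Φ.flow t z)) hf
    (hg.comp (Φ.measurable_flow t)) (fun z => hg_top _) hfg r

end Liouville

/-! ## The line's Rényi pair: pushed-forward fresh local Gibbs law against a local Gibbs reference -/

section LocalGibbs

open Literature.MathematicalPhysics.KineticTheory

/-- The canonical density of a positive profile with positive partition function is positive on the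
hard-sphere domain. [folklore] -/
private theorem canonicalDensity_pos_of_mem' {n : ℕ} {δ : ℝ} {p : T3 × V3 → ℝ}
    (hp : ∀ y, 0 < p y) (hZ : 0 < canonicalPartition (Torus.geometry (Fin 3)) δ n p)
    {z : Config n (Fin 3) T3} (hz : z ∈ hardSphereDomain (Torus.geometry (Fin 3)) n δ) :
    0 < canonicalDensity (Torus.geometry (Fin 3)) δ n p z := by
  rw [canonicalDensity, Set.indicator_of_mem hz, tensorPow]
  exact mul_pos (inv_pos.2 hZ) (Finset.prod_pos fun k _ => hp _)

/-- **The Liouville identity for the line's Rényi pair.** For the hard-sphere system at reduced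
diameter `σ`, a FRESH local Gibbs law `G_s = localGibbsLaw σ a u' θ'` (continuous profiles) pushed
forward to time `r`, and a local Gibbs REFERENCE `G_t = localGibbsLaw σ a' u'' θ''` with continuous
positive profiles and positive partition function (both finite): writing `f, g` for their densities
with respect to the Liouville measure,
`∫ (d(Φ_r)_*G_s / dG_t)^{1+γ} dG_t = ∫ (g∘Φ_r) · (f / g∘Φ_r)^{1+γ} dZ` — i.e. the Hellinger integral
behind `D_{1+γ}((Φ_r)_* G_s ‖ G_t)` is the exponential moment, under the fresh law, of `γ` times the
log-likelihood DROP `log f(z) − log g(Φ_r z)` along the flow (line card §First split, (R2) step 1).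
[folklore] -/
theorem hellingerIntegral_lawAt_localGibbsLaw_eq_lintegral {σ : ℝ} {a θ' a' θ'' : T3 → ℝ}
    {u' u'' : T3 → V3} (N : ℕ)
    (Φ : HardSphereFlow (Torus.geometry (Fin 3)) (hsDiameter σ N) (N + 1))
    [IsFiniteMeasure (localGibbsLaw σ a u' θ' N Φ)] [IsFiniteMeasure (localGibbsLaw σ a' u'' θ'' N Φ)]
    (ha : Continuous a) (hθ' : Continuous θ') (hu' : Continuous u') (ha' : Continuous a')
    (hθ'' : Continuous θ'') (hu'' : Continuous u'') (ha'0 : ∀ x, 0 < a' x) (hθ''0 : ∀ x, 0 < θ'' x)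
    (hZ : 0 < canonicalPartition (Torus.geometry (Fin 3)) (hsDiameter σ N) (N + 1)
      (localGibbsProfile a' u'' θ''))
    {q : ℝ} (hq : 1 < q) (r : ℝ) :
    hellingerIntegral q (Φ.lawAt (localGibbsLaw σ a u' θ' N Φ) r) (localGibbsLaw σ a' u'' θ'' N Φ) =
      ∫⁻ z, ENNReal.ofReal (canonicalDensity (Torus.geometry (Fin 3)) (hsDiameter σ N) (N + 1)
            (localGibbsProfile a' u'' θ'') (Φ.flow r z)) *
          (ENNReal.ofReal (canonicalDensity (Torus.geometry (Fin 3)) (hsDiameter σ N) (N + 1)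
              (localGibbsProfile a u' θ') z) *
            (ENNReal.ofReal (canonicalDensity (Torus.geometry (Fin 3)) (hsDiameter σ N) (N + 1)
              (localGibbsProfile a' u'' θ'') (Φ.flow r z)))⁻¹) ^ q
        ∂(liouville (Torus.geometry (Fin 3)) (N + 1) (hsDiameter σ N)) := by
  set f : Config (N + 1) (Fin 3) T3 → ℝ≥0∞ := fun z => ENNReal.ofReal (canonicalDensity
    (Torus.geometry (Fin 3)) (hsDiameter σ N) (N + 1) (localGibbsProfile a u' θ') z) with hf_def
  set g : Config (N + 1) (Fin 3) T3 → ℝ≥0∞ := fun z => ENNReal.ofReal (canonicalDensity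
    (Torus.geometry (Fin 3)) (hsDiameter σ N) (N + 1) (localGibbsProfile a' u'' θ'') z) with hg_def
  have hfm : Measurable f :=
    (measurable_canonicalDensity _ _ (measurable_localGibbsProfile ha hθ' hu')).ennreal_ofReal
  have hgm : Measurable g :=
    (measurable_canonicalDensity _ _ (measurable_localGibbsProfile ha' hθ'' hu'')).ennreal_ofReal
  have h1 : localGibbsLaw σ a u' θ' N Φ =
      (liouville (Torus.geometry (Fin 3)) (N + 1) (hsDiameter σ N)).withDensity f := rfl
  have h2 : localGibbsLaw σ a' u'' θ'' N Φ =
      (liouville (Torus.geometry (Fin 3)) (N + 1) (hsDiameter σ N)).withDensity g := rfl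
  have i1 : IsFiniteMeasure ((liouville (Torus.geometry (Fin 3)) (N + 1)
      (hsDiameter σ N)).withDensity f) := h1 ▸ inferInstance
  have i2 : IsFiniteMeasure ((liouville (Torus.geometry (Fin 3)) (N + 1)
      (hsDiameter σ N)).withDensity g) := h2 ▸ inferInstance
  -- `g > 0` on the hard-sphere domain, which contains the (invariant, conull) good set
  have hfg : ∀ᵐ z ∂(liouville (Torus.geometry (Fin 3)) (N + 1) (hsDiameter σ N)),
      g (Φ.flow r z) = 0 → f z = 0 := by
    filter_upwards [Φ.ae_mem_good] with z hz hg0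
    exfalso
    have hpos : 0 < canonicalDensity (Torus.geometry (Fin 3)) (hsDiameter σ N) (N + 1)
        (localGibbsProfile a' u'' θ'') (Φ.flow r z) :=
      canonicalDensity_pos_of_mem' (localGibbsProfile_pos ha'0 hθ''0) hZ
        (Φ.good_subset (Φ.mapsTo_good r hz))
    rw [hg_def, ENNReal.ofReal_eq_zero] at hg0
    exact absurd hg0 (not_le.2 hpos)
  rw [h1, h2]
  exact hellingerIntegral_lawAt_withDensity_eq_lintegral Φ hfm hgm (fun _ => ENNReal.ofReal_ne_top)
    hq r hfg

end LocalGibbs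

end Summit.AtomisticToContinuum.HydrodynamicLimit.Theorems.RestartPrinciple.IsentropicRegibbsification

end
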